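import Summits.QuantumFields.GaugeBoot.FreeSubgroupSU2
import HarnessLib

/-!
# A free subgroup of `SO(3)` with rational generators (the Hausdorff–Banach–Tarski pair `cos θ = 3/5`), kernel-checked; `SO(3) ↪ SO(3+k)` (gauge-boot, large-`N` supplement 16, part 6)

HONEST FRAMING (cell `pub-gaugeboot`, page 1 of every file): the venture produces certified bounds
on lattice expectations at stated coupling, gauge group, dimension and torus size; NOT a mass gap,
NOT a continuum limit, NOT a string tension; NOT large `N` unless marked CONDITIONAL; NOT
Yang–Mills-summit-bearing (barriers `FixedCouplingUltralocality`, `PerturbativeInvisibility`).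
Pure group theory; this file certifies no number.  It is the `SO(N)` input of `FreeConfigurations.lean`
(part 7): Shen–Zhu–Zhu's facts are typed for `SO(N)` configurations too
(`LGConfig d (Matrix.specialOrthogonalGroup (Fin N) ℝ)`).

## Content

* `FreeSO3.rotZ = [[3/5, −4/5, 0], [4/5, 3/5, 0], [0, 0, 1]]`, `FreeSO3.rotX = [[1, 0, 0], [0, 3/5, −4/5], [0, 4/5, 3/5]]`
  — the rotations by `arccos(3/5)` about the `z`- and `x`-axes, elements of `SO(3)` with rational entries;
* ★★ `FreeSO3.prod_lval_ne_one` — no non-empty reduced word in `R_z^{±1}, R_x^{±1}` is the identity;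
  ★★ `FreeSO3.lift_rot_injective` — `FreeGroup (Fin 2) →* SO(3)`, `0 ↦ R_z`, `1 ↦ R_x`, is INJECTIVE: the
  classical free rotation group of the Hausdorff–Banach–Tarski paradox, here with the `3-4-5` angle;
* `soBlockEmb k : SO(3) →* SO(3+k)` (`R ↦ diag(R, 1)`), injective.

## Proof

Word for word the rank-one chain of part 1, over `ℤ` instead of `ℤ[i]`: `5R_z^{±1}, 5R_x^{±1}` are integer
matrices (`imat`); modulo `5` each is rank one, `u_x v_xᵀ` (`rmat_eq_vecMulVec`, `decide`), the junction
scalars `v_xᵀ u_y` vanish exactly for `y = x⁻¹` (`junction_ne_zero`, `decide`), so a reduced word reduces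
to a non-zero multiple of `u_first v_lastᵀ`, while `w(R_z, R_x) = 1` would give `5^n · 1 ≡ 0 (mod 5)`.
[folklore] Hausdorff 1914; the `arccos(3/5)` pair with the mod-`5` argument is the textbook proof
(e.g. K. Stromberg, Amer. Math. Monthly 86 (1979) 151, with `1/3`; T. Tao's notes with `3/5`); Tits 1972.
-/

noncomputable section

open Matrix

namespace Summit.QuantumFields.GaugeBoot

/-- `SO(N)` (Mathlib `Matrix.specialOrthogonalGroup (Fin N) ℝ`, the type of Shen–Zhu–Zhu's `SO(N)`
configurations). [folklore] -/
abbrev SO (N : ℕ) : Type := ↥(Matrix.specialOrthogonalGroup (Fin N) ℝ)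

namespace FreeSO3

open FreeSU2 (Letter zmod5_mul_ne_zero)

/-! ## The integer matrices `5R^{±1}` and their reduction modulo `5` -/

/-- `imat (0,true) = 5R_z`, `imat (0,false) = 5R_z⁻¹ = (5R_z)ᵀ`, `imat (1,true) = 5R_x`, `imat (1,false) = 5R_x⁻¹`,
over `ℤ`. [folklore] -/
def imat (x : Letter) : Matrix (Fin 3) (Fin 3) ℤ :=
  if x.1 = 0 then (if x.2 then !![3, -4, 0; 4, 3, 0; 0, 0, 5] else !![3, 4, 0; -4, 3, 0; 0, 0, 5])
  else (if x.2 then !![5, 0, 0; 0, 3, -4; 0, 4, 3] else !![5, 0, 0; 0, 3, 4; 0, -4, 3])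

/-- The reduced letters `imat x (mod 5)` over `𝔽₅`. [folklore] -/
def rmat (x : Letter) : Matrix (Fin 3) (Fin 3) (ZMod 5) := (imat x).map (Int.castRingHom (ZMod 5))

/-- Column vector of the rank-one factorisation `rmat x = u_x v_xᵀ`. [folklore] -/
def uvec (x : Letter) : Fin 3 → ZMod 5 :=
  if x.1 = 0 then (if x.2 then ![3, 4, 0] else ![3, 1, 0]) else (if x.2 then ![0, 3, 4] else ![0, 3, 1])

/-- Row vector of the rank-one factorisation `rmat x = u_x v_xᵀ`. [folklore] -/
def vvec (x : Letter) : Fin 3 → ZMod 5 :=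
  if x.1 = 0 then (if x.2 then ![1, 2, 0] else ![1, 3, 0]) else (if x.2 then ![0, 1, 2] else ![0, 1, 3])

/-- **Each reduced letter is rank one**: `rmat x = u_x v_xᵀ` (four `3 × 3` identities over `𝔽₅`). [folklore] -/
theorem rmat_eq_vecMulVec : ∀ x : Letter, rmat x = vecMulVec (uvec x) (vvec x) := by decide

/-- **Junctions do not vanish**: `v_xᵀ u_y ≠ 0` unless `y = x⁻¹`. [folklore] -/
theorem junction_ne_zero : ∀ x y : Letter, (x.1 = y.1 → x.2 = y.2) → vvec x ⬝ᵥ uvec y ≠ 0 := by decide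

/-- A non-zero multiple of `u_x v_zᵀ` is a non-zero matrix. [folklore] -/
theorem smul_vecMulVec_uvec_vvec_ne_zero : ∀ (c : ZMod 5) (x z : Letter), c ≠ 0 → c • vecMulVec (uvec x) (vvec z) ≠ 0 := by
  decide

/-- ★ **The rank-one chain** for `SO(3)`: for a REDUCED word `x :: L`, the product of the reduced letters is a
non-zero multiple of `u_x v_{last}ᵀ`. [folklore] -/
theorem prod_rmat_cons (x : Letter) (L : List Letter) (h : FreeGroup.IsReduced (x :: L)) :
    ∃ c : ZMod 5, c ≠ 0 ∧ ((x :: L).map rmat).prod = c • vecMulVec (uvec x) (vvec ((x :: L).getLast (List.cons_ne_nil x L))) := by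
  induction L generalizing x with
  | nil => exact ⟨1, by decide, by simp [rmat_eq_vecMulVec]⟩
  | cons y L ih =>
    obtain ⟨hxy, h'⟩ := FreeGroup.isReduced_cons_cons.1 h
    obtain ⟨c', hc', hprod⟩ := ih y h'
    refine ⟨c' * (vvec x ⬝ᵥ uvec y), zmod5_mul_ne_zero _ _ hc' (junction_ne_zero x y hxy), ?_⟩
    rw [List.map_cons, List.prod_cons, hprod, rmat_eq_vecMulVec, Matrix.mul_smul, vecMulVec_mul_vecMulVec,
      vecMulVec_smul, smul_smul, List.getLast_cons_cons]

/-- ★ A non-empty reduced word has non-zero reduction modulo `5`. [folklore] -/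
theorem prod_rmat_ne_zero {L : List Letter} (hL : L ≠ []) (h : FreeGroup.IsReduced L) : (L.map rmat).prod ≠ 0 := by
  obtain ⟨x, L, rfl⟩ := List.exists_cons_of_ne_nil hL
  obtain ⟨c, hc, e⟩ := prod_rmat_cons x L h
  rw [e]
  exact smul_vecMulVec_uvec_vvec_ne_zero c x _ hc

/-- The reduction of the integer product is the product of the reduced letters. [folklore] -/
theorem map_prod_imat (L : List Letter) : ((L.map imat).prod).map (Int.castRingHom (ZMod 5)) = (L.map rmat).prod := by
  change RingHom.mapMatrix (Int.castRingHom (ZMod 5)) (L.map imat).prod = _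
  rw [map_list_prod, List.map_map]
  rfl

/-! ## The real side: `R_z, R_x ∈ SO(3)` -/

/-- The real letters `cmat x = imat x` read in `ℝ` (`= 5R^{±1}`). [folklore] -/
def cmat (x : Letter) : Matrix (Fin 3) (Fin 3) ℝ := (imat x).map (Int.castRingHom ℝ)

/-- The real reading of the integer product is the product of the real letters. [folklore] -/
theorem map_prod_imat_real (L : List Letter) : ((L.map imat).prod).map (Int.castRingHom ℝ) = (L.map cmat).prod := by
  change RingHom.mapMatrix (Int.castRingHom ℝ) (L.map imat).prod = _
  rw [map_list_prod, List.map_map]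
  rfl

/-- **`R_z ∈ SO(3)`**: the rotation by `arccos(3/5)` about the `z`-axis. [folklore] -/
def rotZ : SO 3 :=
  ⟨!![(3/5 : ℝ), -4/5, 0; 4/5, 3/5, 0; 0, 0, 1], by
    rw [Matrix.mem_specialOrthogonalGroup_iff, Matrix.mem_orthogonalGroup_iff]
    refine ⟨?_, ?_⟩
    · ext i j
      fin_cases i <;> fin_cases j <;> simp [Matrix.mul_apply, Fin.sum_univ_three] <;> norm_num
    · rw [Matrix.det_fin_three]; simp; norm_num⟩

/-- **`R_x ∈ SO(3)`**: the rotation by `arccos(3/5)` about the `x`-axis. [folklore] -/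
def rotX : SO 3 :=
  ⟨!![(1 : ℝ), 0, 0; 0, 3/5, -4/5; 0, 4/5, 3/5], by
    rw [Matrix.mem_specialOrthogonalGroup_iff, Matrix.mem_orthogonalGroup_iff]
    refine ⟨?_, ?_⟩
    · ext i j
      fin_cases i <;> fin_cases j <;> simp [Matrix.mul_apply, Fin.sum_univ_three] <;> norm_num
    · rw [Matrix.det_fin_three]; simp; norm_num⟩

/-- The two generators as a family `Fin 2 → SO 3`. [folklore] -/
def rot : Fin 2 → SO 3 := ![rotZ, rotX]

/-- The value of a letter: `rot i` or `(rot i)⁻¹`. [folklore] -/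
def lval (x : Letter) : SO 3 := cond x.2 (rot x.1) (rot x.1)⁻¹

/-- In `SO(3)` the inverse is the transpose (Mathlib: `star`, with the trivial star on `ℝ`). [folklore] -/
theorem coe_inv_apply (V : SO 3) (i j : Fin 3) : (V⁻¹).1 i j = V.1 j i := rfl

/-- **`5 · (letter value) = the integer letter`**, for each of the four letters. [folklore] -/
theorem five_smul_lval (x : Letter) : (5 : ℝ) • (lval x).1 = cmat x := by
  obtain ⟨i, b⟩ := x
  fin_cases i <;> cases b <;>
    (ext j k
     fin_cases j <;> fin_cases k <;>
       simp [lval, rot, rotZ, rotX, cmat, imat, coe_inv_apply, Matrix.map_apply] <;> norm_num)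

/-- `5^n · w(R_z, R_x) = ∏ cmat` for every word of length `n`. [folklore] -/
theorem pow_smul_prod_lval (L : List Letter) : (5 : ℝ) ^ L.length • ((L.map lval).prod).1 = (L.map cmat).prod := by
  induction L with
  | nil => simp
  | cons x L ih =>
    rw [List.map_cons, List.prod_cons, List.map_cons, List.prod_cons, List.length_cons, pow_succ', ← ih,
      ← five_smul_lval, Submonoid.coe_mul, Matrix.smul_mul, Matrix.mul_smul, smul_smul]

/-- ★★ **No non-empty reduced word in `R_z^{±1}, R_x^{±1}` is the identity of `SO(3)`.** [folklore] -/
theorem prod_lval_ne_one {L : List Letter} (hL : L ≠ []) (h : FreeGroup.IsReduced L) : (L.map lval).prod ≠ 1 := by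
  intro h1
  apply prod_rmat_ne_zero hL h
  have hC : (L.map cmat).prod = (5 : ℝ) ^ L.length • (1 : Matrix (Fin 3) (Fin 3) ℝ) := by
    rw [← pow_smul_prod_lval, h1, Submonoid.coe_one]
  rw [← map_prod_imat_real] at hC
  rw [← map_prod_imat]
  have hn : L.length ≠ 0 := fun h0 => hL (List.eq_nil_of_length_eq_zero h0)
  ext i j
  have hij := congr_fun (congr_fun hC i) j
  rw [Matrix.map_apply, Matrix.smul_apply, Matrix.one_apply] at hij
  rw [Matrix.map_apply, Matrix.zero_apply]
  by_cases h' : i = j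
  · rw [if_pos h', smul_eq_mul, mul_one] at hij
    have h5r : (((L.map imat).prod i j : ℤ) : ℝ) = (5 : ℝ) ^ L.length := hij
    have h5 : ((L.map imat).prod i j : ℤ) = 5 ^ L.length := by exact_mod_cast h5r
    rw [h5, map_pow, map_ofNat, show (5 : ZMod 5) = 0 from rfl, zero_pow hn]
  · rw [if_neg h', smul_zero] at hij
    have h0r : (((L.map imat).prod i j : ℤ) : ℝ) = 0 := hij
    have h0 : ((L.map imat).prod i j : ℤ) = 0 := by exact_mod_cast h0r
    rw [h0, map_zero]

/-- ★★ **`SO(3)` contains a free group of rank two with rational generators**: the homomorphism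
`FreeGroup (Fin 2) →* SO(3)`, `0 ↦ R_z`, `1 ↦ R_x` (rotations by `arccos(3/5)` about orthogonal axes), is
injective — the free rotation group of the Hausdorff–Banach–Tarski paradox. [folklore] -/
theorem lift_rot_injective : Function.Injective (FreeGroup.lift rot) := by
  rw [injective_iff_map_eq_one]
  intro g hg
  by_contra hne
  have hW : g.toWord ≠ [] := by rwa [Ne, FreeGroup.toWord_eq_nil_iff]
  have hlift := FreeGroup.lift_mk (f := rot) (L := g.toWord)
  rw [FreeGroup.mk_toWord, hg] at hlift
  exact prod_lval_ne_one hW FreeGroup.isReduced_toWord hlift.symm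

end FreeSO3

/-! ## The block embedding `SO(3) ↪ SO(3+k)` -/

/-- `diag(R, 1_k)` as a `(3+k) × (3+k)` real matrix. [folklore] -/
def soBlockMat (k : ℕ) (R : Matrix (Fin 3) (Fin 3) ℝ) : Matrix (Fin (3 + k)) (Fin (3 + k)) ℝ :=
  Matrix.reindex finSumFinEquiv finSumFinEquiv (Matrix.fromBlocks R 0 0 (1 : Matrix (Fin k) (Fin k) ℝ))

/-- `diag(1, 1) = 1`. [folklore] -/
theorem soBlockMat_one (k : ℕ) : soBlockMat k 1 = 1 := by
  rw [soBlockMat, fromBlocks_one]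
  exact (Matrix.reindexRingEquiv ℝ (finSumFinEquiv (m := 3) (n := k))).map_one

/-- `diag(RS, 1) = diag(R, 1) diag(S, 1)`. [folklore] -/
theorem soBlockMat_mul (k : ℕ) (R S : Matrix (Fin 3) (Fin 3) ℝ) : soBlockMat k (R * S) = soBlockMat k R * soBlockMat k S := by
  have h := (Matrix.reindexRingEquiv ℝ (finSumFinEquiv (m := 3) (n := k))).map_mul (fromBlocks R 0 0 (1 : Matrix (Fin k) (Fin k) ℝ))
    (fromBlocks S 0 0 1)
  rw [fromBlocks_multiply] at h
  simp only [Matrix.mul_zero, Matrix.zero_mul, add_zero, zero_add, Matrix.mul_one] at h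
  exact h

/-- `diag(Rᵀ, 1) = diag(R, 1)ᵀ`. [folklore] -/
theorem soBlockMat_transpose (k : ℕ) (R : Matrix (Fin 3) (Fin 3) ℝ) : soBlockMat k Rᵀ = (soBlockMat k R)ᵀ := by
  rw [soBlockMat, soBlockMat, Matrix.reindex_apply, Matrix.reindex_apply, transpose_submatrix, fromBlocks_transpose]
  simp

/-- `det diag(R, 1) = det R`. [folklore] -/
theorem det_soBlockMat (k : ℕ) (R : Matrix (Fin 3) (Fin 3) ℝ) : (soBlockMat k R).det = R.det := by
  rw [soBlockMat, det_reindex_self, det_fromBlocks_zero₂₁, det_one, mul_one]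

/-- `R ↦ diag(R, 1)` is injective. [folklore] -/
theorem soBlockMat_injective (k : ℕ) : Function.Injective (soBlockMat k) := fun V W h => by
  have h' := (Matrix.reindex (finSumFinEquiv (m := 3) (n := k)) finSumFinEquiv).injective h
  exact (fromBlocks_inj.1 h').1

/-- **The block embedding `SO(3) →* SO(3+k)`, `R ↦ diag(R, 1)`.** [folklore] -/
def soBlockEmb (k : ℕ) : SO 3 →* SO (3 + k) where
  toFun V := ⟨soBlockMat k V.1, by
    rw [Matrix.mem_specialOrthogonalGroup_iff, Matrix.mem_orthogonalGroup_iff]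
    refine ⟨?_, by rw [det_soBlockMat]; exact V.2.2⟩
    have hV : V.1 * V.1ᵀ = 1 := (Matrix.mem_orthogonalGroup_iff (Fin 3) ℝ).1 V.2.1
    rw [← soBlockMat_transpose, ← soBlockMat_mul, hV, soBlockMat_one]⟩
  map_one' := Subtype.ext (soBlockMat_one k)
  map_mul' V W := Subtype.ext (soBlockMat_mul k V.1 W.1)

/-- Unfolding lemma. [folklore] -/
theorem coe_soBlockEmb (k : ℕ) (V : SO 3) : (soBlockEmb k V).1 = soBlockMat k V.1 := rfl

/-- **The block embedding is injective.** [folklore] -/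
theorem soBlockEmb_injective (k : ℕ) : Function.Injective (soBlockEmb k) := fun _ _ h =>
  Subtype.ext (soBlockMat_injective k (congrArg Subtype.val h))

/-- ★★ **For every `N ≥ 3`, `SO(N)` contains a free group of rank two** (an injective homomorphism
`FreeGroup (Fin 2) →* SO(N)`, `0 ↦ diag(R_z, 1)`, `1 ↦ diag(R_x, 1)`). [folklore] -/
theorem exists_freeGroup_pair_embedding_SO {N : ℕ} (hN : 3 ≤ N) : ∃ ψ : FreeGroup (Fin 2) →* SO N, Function.Injective ψ := by
  obtain ⟨k, rfl⟩ := Nat.exists_eq_add_of_le hN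
  exact ⟨(soBlockEmb k).comp (FreeGroup.lift FreeSO3.rot), (soBlockEmb_injective k).comp FreeSO3.lift_rot_injective⟩

end Summit.QuantumFields.GaugeBoot

end
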